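import Summits.QuantumFields.YangMills.Theorems.BalabanUVNodesPortU8LocUnivCurlCurlKernelRow
import Summits.QuantumFields.YangMills.Theorems.BalabanUVNodesPortU8LocUnivDecayClause1
import Summits.QuantumFields.YangMills.Theorems.BalabanUVNodesK0RecordFormatNamesLemmas13

/-!
# Port piece U8 — ★★★ THE `d*d` (CURL) CLAUSE OF (‴-LocUniv), PROVED: `norm_recordHrLocξ_univ_curlStencil_le`
# `‖Σ_ν [(Hr(x,μ)+Hr(x+e_μ,ν)−Hr(x+e_ν,μ)−Hr(x,ν)) − (same at x−e_ν)]‖ ≤ C₄·η³·e^{−δ₄·tdist(coarsenTo (k+1) x, y)}` for `Hr = recordHrLocξ F θ k K univ a (μ,y)`,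
# with `C₄ ≥ 0`, `δ₄ > 0` depending on the family `F` only — clause 4 of the displayed token at the letter (one spare level `k + 2 ≤ m + K`, automatic at the port's `K`)

Cell `ym-nodeO-ideate` ∕ `ym-balaban-port`, porter `ymgap-nodeO-port-PTB-1` (gen 4).  JOIN-side helper for **stmt-QuantumFields-27238** (K0ᴬ), `--supports … --as helper`.
[15] = [Balaban1985Variational], [B5] = [Balaban1984PropagatorsI], [B6] = [Balaban1984PropagatorsII], [B8] = [Balaban1985RegularSpaces].

WHAT IS PROVED (kernel, sorry-free).
§1 `curlStencil_eq_dcsE_dcE` — the token's plaquette∕curl stencil `Σ_ν [C_{μν}(x) − C_{μν}(x − e_ν)]`, `C_{μν}(z) = A(z,μ) + A(z+e_μ,ν) − A(z+e_ν,μ) − A(z,ν)`, IS `(∂*₁∂₁A)(x, μ)`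
   ([B8] (1.2) at `U = 1`, ✓`B8Eq12HodgeLaplacianV1.dcsE_apply`; the `ν = μ` term vanishes, `C_{νμ} = −C_{μν}`).
§2 `curlStencil_recordHrLocξ_eq_smul` — the colour wrapper commutes with the stencil: for `Hr = recordHrLocξ … univ a (μ,y)` the matrix stencil is
   `(η·(∂*₁∂₁ windowResp univ (μ,y))(b)) • ρ₈(bV a)`.
§3 ★★★ `norm_recordHrLocξ_univ_curlStencil_le` — CLAUSE 4: `∃ C₄ ≥ 0, δ₄ > 0` (from ✓`abs_curlCurl_windowResp_univ_le`, `δ₄ = δ∕4`) with the displayed bound for all `a₀ ε₂₉ K k`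
   (`k + 2 ≤ m + K`) `a μ y b` — ✓ kernel row (η²) × `η` (chart units) × `‖ρ₈(bV a)‖ ≤ 1` (✓`thetaFill_norm_ρ8_bV_le_one`) and the distance dictionary ✓`tdist_le_mul_torusSupNorm`.

HONEST FRAMING.  Bookkeeping over PROVED tree theorems (r03's [B6] two-scale rows, DEF-1∕PTZ-1's window currency, [B8] (1.2)); clauses 1, 2, 4 of (‴-LocUniv) are now tree
theorems; clause 3 (the Laplacian face = (137) + [15] (140) `∂∂*H`) and (Tok-cmpU-cap) remain DISPLAYED; nothing of Bałaban's renormalization-group analysis asserted; K0ᴬ 27238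
OPEN; NODE O 0∕1; COUNT 8∕28 · K 1∕4 UNMOVED; finite `𝕋⁴_{L^K}` at fixed ε — NOT continuum ∕ OS ∕ Clay; **the Yang–Mills mass gap (Clay) is NOT proved by any of this.**
-/

noncomputable section

open scoped BigOperators

namespace Summit.QuantumFields.YangMills.Theorems.PortU8

open Literature.MathematicalPhysics.QuantumFieldTheory.Balaban1983to89
open Literature.MathematicalPhysics.QuantumFieldTheory.Balaban1983to89.Node00
open Literature.MathematicalPhysics.QuantumFieldTheory.Balaban1983to89.T4Continuum (T4Family)
open Literature.MathematicalPhysics.QuantumFieldTheory.BalabanImbrieJaffe1984to88.BIJ85AxialPropagator411 (BondSpace)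
open Literature.MathematicalPhysics.QuantumFieldTheory.Balaban1983to89.B6SectAOperatorsV1 (dcE dcsE dcE_apply)
open Literature.MathematicalPhysics.QuantumFieldTheory.Balaban1983to89.LatticeFieldCalculus (curl pdiffAdj)
open Literature.MathematicalPhysics.QuantumFieldTheory.Balaban1983to89.B5Eq117TorusCarriers (Mk)
open Literature.MathematicalPhysics.QuantumFieldTheory.Balaban1983to89.B5Eq118OneStroke (iterBlockOf)
open Literature.MathematicalPhysics.QuantumFieldTheory.Balaban1983to89.B4TorusKernel.MultiPeriod (torusSupNorm)
open Literature.MathematicalPhysics.QuantumFieldTheory.Balaban1983to89.B6LowerBound2153Torus (rep)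
open Summit.QuantumFields.YangMills.Theorems.K0RecordFormatNames

/-! ## §1  The token's curl stencil is `∂*₁∂₁` -/

/-- **THE PLAQUETTE STENCIL OF THE TOKEN IS `(∂*∂A)(x, μ)` AT LATTICE FACTOR `1`**: with `C_{μν}(z) = A(z,μ) + A(z+e_μ,ν) − A(z+e_ν,μ) − A(z,ν)`,
`Σ_ν [C_{μν}(x) − C_{μν}(x − e_ν)] = (dcsE 1 (dcE 1 A)) ⟨x, μ⟩` — [B8] (1.2) `(∂*F)_μ(x) = Σ_{ν<μ} ∂*_ν F_{νμ}(x) − Σ_{ν>μ} ∂*_ν F_{μν}(x)` with `F = ∂A`, `F_{νμ} = −C_{μν}`, and the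
`ν = μ` term of the stencil vanishing identically. [cite: Balaban1985RegularSpaces, (1.2) p.76; Balaban1984PropagatorsII, (2.19) p.226; Balaban1985Variational, (190) p.308] -/
theorem curlStencil_eq_dcsE_dcE {P : Params} (A : BondSpace P) (b : PBond P 0) :
    ∑ ν : Fin P.d, ((A ⟨b.src, b.dir⟩ + A ⟨b.src.shift b.dir, ν⟩ - A ⟨b.src.shift ν, b.dir⟩ - A ⟨b.src, ν⟩) -
        (A ⟨b.src.unshift ν, b.dir⟩ + A ⟨(b.src.unshift ν).shift b.dir, ν⟩ - A ⟨(b.src.unshift ν).shift ν, b.dir⟩ - A ⟨b.src.unshift ν, ν⟩)) =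
      dcsE 1 (dcE 1 A) b := by
  rw [B8Eq12HodgeLaplacianV1.dcsE_apply, ← Finset.sum_sub_distrib]
  refine Finset.sum_congr rfl fun ν _ => ?_
  rcases lt_trichotomy ν b.dir with h | h | h
  · rw [dif_pos h, dif_neg (not_lt.2 h.le)]
    simp only [pdiffAdj, dcE_apply, curl, one_smul, sub_zero]
    ring
  · subst h
    rw [dif_neg (lt_irrefl _)]
    ring
  · rw [dif_neg (not_lt.2 h.le), dif_pos h]
    simp only [pdiffAdj, dcE_apply, curl, one_smul, zero_sub]
    ring

variable (F : T4Family)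

/-! ## §2  The colour wrapper commutes with the stencil -/

/-- **THE MATRIX STENCIL FACTORS**: for `Hr = recordHrLocξ F θ k K univ a (μ, y)` (`= η·windowResp·ρ₈(bV a)` entrywise) the token's stencil is the scalar stencil times the
fixed colour matrix: `Σ_ν […] = (η·(∂*₁∂₁ windowResp univ (μ,y))(b)) • ρ₈(bV a)`. [cite: Balaban1987RG1, (3.37) p.277, (4.35) p.290 (bookkeeping); Balaban1985RegularSpaces, (1.2) p.76] -/
theorem curlStencil_recordHrLocξ_eq_smul (a₀ ε₂₉ : ℝ) (k K : ℕ) (a : (thetaFill F a₀ ε₂₉).ιβ) (μ : Fin (F.P K).d) (y : Site (F.P K) (k + 1))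
    (b : PBond (F.P K) 0) :
    letI θ := thetaFill F a₀ ε₂₉; letI := θ.instVβ₁; letI := θ.instVβ₂; letI := θ.instιβ
    letI Hr : PBond (F.P K) 0 → Fin 2 → Fin 2 → ℂ := fun b' => recordHrLocξ F θ k K Finset.univ a (μ, y) b'
    (∑ ν : Fin (F.P K).d, ((Hr ⟨b.src, b.dir⟩ + Hr ⟨(b.src).shift b.dir, ν⟩ - Hr ⟨(b.src).shift ν, b.dir⟩ - Hr ⟨b.src, ν⟩) -
        (Hr ⟨b.src.unshift ν, b.dir⟩ + Hr ⟨(b.src.unshift ν).shift b.dir, ν⟩ - Hr ⟨(b.src.unshift ν).shift ν, b.dir⟩ - Hr ⟨b.src.unshift ν, ν⟩))) =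
      ((((F.P K).eta (k + 1) * dcsE 1 (dcE 1 (WithLp.toLp 2 (windowResp F k K Finset.univ (μ, y)))) b : ℝ) : ℂ)) •
        (fun i i' : Fin 2 => θ.ρ8 (θ.bV a) i i') := by
  letI θ := thetaFill F a₀ ε₂₉; letI := θ.instVβ₁; letI := θ.instVβ₂; letI := θ.instιβ
  rw [← curlStencil_eq_dcsE_dcE]
  funext i i'
  simp only [Finset.sum_apply, Pi.sub_apply, Pi.add_apply, Pi.smul_apply, smul_eq_mul, recordHrLocξ, windowRespξ,
    Complex.ofReal_mul, Complex.ofReal_sum, Finset.mul_sum, Finset.sum_mul]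
  refine Finset.sum_congr rfl fun ν _ => ?_
  push_cast
  ring

/-! ## §3  ★★★ Clause 4 of (‴-LocUniv) -/

/-- ★★★ **THE `d*d` CLAUSE OF (‴-LocUniv), PROVED**: there are `C₄ ≥ 0`, `δ₄ > 0` depending on the family `F` only such that for all `a₀ ε₂₉`, every volume `K` and level
`k` with one spare level (`k + 2 ≤ m + K`), colour `a`, label `(μ, y)` and fine bond `b`, the token's plaquette stencil of `Hr = recordHrLocξ F θ k K univ a (μ, y)` has
sup-entry norm `≤ C₄·η³·e^{−δ₄·tdist(coarsenTo (k+1) b₋, y)}`, `η = eta (k+1)`. [cite: Balaban1985Variational, (190) p.308, (137) p.298; Balaban1984PropagatorsII, (2.148)-(2.150) p.249; Balaban1987RG1, (4.35) p.290] -/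
theorem norm_recordHrLocξ_univ_curlStencil_le :
    ∃ C₄ δ₄ : ℝ, 0 ≤ C₄ ∧ 0 < δ₄ ∧ ∀ (a₀ ε₂₉ : ℝ) (K k : ℕ) (_hk2 : k + 1 + 1 ≤ (F.P K).m + (F.P K).K),
      letI θ := thetaFill F a₀ ε₂₉; letI := θ.instVβ₁; letI := θ.instVβ₂; letI := θ.instιβ;
      ∀ (a : θ.ιβ) (μ : Fin (F.P K).d) (y : Site (F.P K) (k + 1)),
      letI Hr : PBond (F.P K) 0 → Fin 2 → Fin 2 → ℂ := fun b' => recordHrLocξ F θ k K Finset.univ a (μ, y) b';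
      ∀ b : PBond (F.P K) 0,
        ‖∑ ν : Fin (F.P K).d, ((Hr ⟨b.src, b.dir⟩ + Hr ⟨(b.src).shift b.dir, ν⟩ - Hr ⟨(b.src).shift ν, b.dir⟩ - Hr ⟨b.src, ν⟩) -
          (Hr ⟨b.src.unshift ν, b.dir⟩ + Hr ⟨(b.src.unshift ν).shift b.dir, ν⟩ - Hr ⟨(b.src.unshift ν).shift ν, b.dir⟩ - Hr ⟨b.src.unshift ν, ν⟩))‖ ≤
          C₄ * (F.P K).eta (k + 1) ^ 3 * Real.exp (-(δ₄ * (Site.tdist (coarsenTo (k + 1) b.src) y : ℝ))) := by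
  obtain ⟨δ, hδ, C, hC, hrow⟩ := abs_curlCurl_windowResp_univ_le F
  refine ⟨C, δ / 4, hC, by positivity, fun a₀ ε₂₉ K k hk2 a μ y b => ?_⟩
  letI θ := thetaFill F a₀ ε₂₉; letI := θ.instVβ₁; letI := θ.instVβ₂; letI := θ.instιβ
  have hη0 : 0 ≤ (F.P K).eta (k + 1) := by unfold Params.eta; exact (pow_pos (inv_pos.2 (F.P K).cast_L_pos) _).le
  have hR0 : 0 ≤ ‖fun i i' : Fin 2 => θ.ρ8 (θ.bV a) i i'‖ := norm_nonneg _
  have hR1 : ‖fun i i' : Fin 2 => θ.ρ8 (θ.bV a) i i'‖ ≤ 1 := thetaFill_norm_ρ8_bV_le_one F a₀ ε₂₉ a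
  have hS := hrow K k hk2 (μ, y) b
  have hdist := tdist_le_mul_torusSupNorm F (coarsenTo (k + 1) b.src) y
  have hexp : Real.exp (-(δ * torusSupNorm (Mk (F.P K) (k + 1)) (rep (Mk (F.P K) (k + 1)) (iterBlockOf (k + 1) b.src) - rep (Mk (F.P K) (k + 1)) y))) ≤
      Real.exp (-(δ / 4 * (Site.tdist (coarsenTo (k + 1) b.src) y : ℝ))) := by
    refine Real.exp_le_exp.2 (neg_le_neg ?_)
    rw [← coarsenTo_eq_iterBlockOf]
    have := mul_le_mul_of_nonneg_left hdist hδ.le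
    linarith
  rw [curlStencil_recordHrLocξ_eq_smul F a₀ ε₂₉ k K a μ y b, norm_smul, Complex.norm_real, Real.norm_eq_abs, abs_mul, abs_of_nonneg hη0]
  calc (F.P K).eta (k + 1) * |dcsE 1 (dcE 1 (WithLp.toLp 2 (windowResp F k K Finset.univ (μ, y)))) b| * ‖fun i i' : Fin 2 => θ.ρ8 (θ.bV a) i i'‖
      ≤ (F.P K).eta (k + 1) * (C * (F.P K).eta (k + 1) ^ 2 * Real.exp (-(δ / 4 * (Site.tdist (coarsenTo (k + 1) b.src) y : ℝ)))) * 1 := by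
        refine mul_le_mul (mul_le_mul_of_nonneg_left (hS.trans ?_) hη0) hR1 hR0 (mul_nonneg hη0 (by positivity))
        exact mul_le_mul_of_nonneg_left hexp (by positivity)
    _ = C * (F.P K).eta (k + 1) ^ 3 * Real.exp (-(δ / 4 * (Site.tdist (coarsenTo (k + 1) b.src) y : ℝ))) := by ring

end Summit.QuantumFields.YangMills.Theorems.PortU8

end
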